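import Literature.AlgebraicGeometry.Modules.FlatSectionsRegular
import Mathlib.Topology.Sheaves.LocallySurjective
import Mathlib.CategoryTheory.Sites.LocallyInjective
import Mathlib.Topology.Sheaves.SheafCondition.UniqueGluing
import HarnessLib

/-!
# The sheafification of a presheaf with locally torsion-free sections has no torsion

Let `X` be a topological space, `P` a presheaf of abelian groups on `X` and `q` an integer. Suppose
every point of `X` has ARBITRARILY SMALL open neighbourhoods `W` on which `P(W)` has no `q`-torsion
(`h : ∀ U x, x ∈ U → ∃ W, x ∈ W ∧ W ≤ U ∧ ∀ s : P(W), q • s = 0 → s = 0`; nothing is asked of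
`P(U)` for general `U`). Then the sheafification `P♯ = (presheafToSheaf _ Ab).obj P` has no
`q`-torsion at all:

* `sheafify_eq_zero_of_zsmul_eq_zero_of_locally` — a section `t ∈ P♯(U)` with `q • t = 0` is zero.
  Proof: `P → P♯` is locally surjective and locally injective (Mathlib:
  `Presheaf.isLocallySurjective_toSheafify'`, `Presheaf.isLocallyInjective_toSheafify'`), so near
  each point `t` is the image of some `s ∈ P(V)` with `q • s` vanishing on a smaller `V'`; shrinking
  `V'` to a torsion-free `W` kills `s|_W`, hence `t|_W`; and `P♯` is separated;
* `mono_zsmul_id_sheafify_of_locally` — hence `q • 𝟙 P♯` is a monomorphism of sheaves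
  (`Modules/FlatSectionsRegular.mono_zsmul_id_of_forall`).

Use (sequel `Crystalline/DeRhamComplexTorsionFree`): the terms `Ωʲ = (⋀ʲ Ω¹)♯` of the algebraic
de Rham complex of a smooth scheme over a ring in which `q` is regular (e.g. `𝒳/W(k)`, `q = p`),
whose presheaf `U ↦ ⋀ʲ_{Γ(U)} Ω[Γ(U)⁄A]` is free — hence torsion-free — on the standard-smooth
affine charts, which form a neighbourhood basis. [folklore]
Everything is proved; no named facts.
-/

noncomputable section

namespace Literature.AlgebraicGeometry.Modules

open CategoryTheory TopologicalSpace Opposite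

universe u

variable {X : TopCat.{u}} (P : (Opens X)ᵒᵖ ⥤ AddCommGrpCat.{u}) (q : ℤ)

/-- Naturality of `P → P♯` on elements: `(s|_W)♯ = (s♯)|_W`. [folklore] -/
theorem toSheafify_app_map {V W : Opens X} (g : W ⟶ V) (s : P.obj (op V)) :
    (toSheafify (Opens.grothendieckTopology X) P).app (op W) (P.map g.op s) =
      ((presheafToSheaf (Opens.grothendieckTopology X) AddCommGrpCat.{u}).obj P).obj.map g.op
        ((toSheafify (Opens.grothendieckTopology X) P).app (op V) s) := by
  have h := (toSheafify (Opens.grothendieckTopology X) P).naturality g.op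
  exact CategoryTheory.congr_fun h s

/-- **Sections of the sheafification of a locally torsion-free presheaf have no torsion.** If
every point has arbitrarily small open neighbourhoods `W` with `P(W)` free of `q`-torsion, then a
section `t` of `P♯` over any open `U` with `q • t = 0` vanishes. [folklore] -/
theorem sheafify_eq_zero_of_zsmul_eq_zero_of_locally
    (h : ∀ (U : Opens X) (x : X), x ∈ U →
      ∃ W : Opens X, x ∈ W ∧ W ≤ U ∧ ∀ s : P.obj (op W), q • s = 0 → s = 0)
    (U : Opens X)
    (t : ((presheafToSheaf (Opens.grothendieckTopology X) AddCommGrpCat.{u}).obj P).obj.obj (op U))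
    (ht : q • t = 0) : t = 0 := by
  have hsurj : TopCat.Presheaf.IsLocallySurjective (toSheafify (Opens.grothendieckTopology X) P) :=
    (inferInstance :
      Presheaf.IsLocallySurjective (Opens.grothendieckTopology X)
        (toSheafify (Opens.grothendieckTopology X) P))
  haveI hinj : Presheaf.IsLocallyInjective (Opens.grothendieckTopology X)
      (toSheafify (Opens.grothendieckTopology X) P) := inferInstance
  -- near each point of `U`, `t` vanishes
  have key : ∀ x : U, ∃ W : Opens X, (x : X) ∈ W ∧ ∃ i : W ≤ U,
      ((presheafToSheaf (Opens.grothendieckTopology X) AddCommGrpCat.{u}).obj P).obj.map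
        (homOfLE i).op t = 0 := by
    rintro ⟨x, hx⟩
    obtain ⟨V, hVU, ⟨s, hs⟩, hxV⟩ := (TopCat.Presheaf.isLocallySurjective_iff _).1 hsurj U t x hx
    have hs' : (toSheafify (Opens.grothendieckTopology X) P).app (op V) s =
        ((presheafToSheaf (Opens.grothendieckTopology X) AddCommGrpCat.{u}).obj P).obj.map
          (homOfLE hVU).op t := hs
    -- `q • s` and `0` have the same image, so they agree on a covering sieve of `V`
    have h1 : (toSheafify (Opens.grothendieckTopology X) P).app (op V) (q • s) =
        (toSheafify (Opens.grothendieckTopology X) P).app (op V) 0 := by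
      rw [map_zsmul, map_zero, hs', ← map_zsmul, ht, map_zero]
    have h2 := Presheaf.equalizerSieve_mem (Opens.grothendieckTopology X)
      (toSheafify (Opens.grothendieckTopology X) P) (q • s) 0 h1
    obtain ⟨V', f, hf, hxV'⟩ := (Opens.mem_grothendieckTopology X).1 h2 x hxV
    change P.map f.op (q • s) = P.map f.op 0 at hf
    rw [map_zsmul, map_zero] at hf
    -- shrink to a torsion-free neighbourhood `W`
    obtain ⟨W, hxW, hWV', hW⟩ := h V' x hxV'
    have h3 : P.map (homOfLE hWV' ≫ f).op s = 0 := by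
      apply hW
      have h4 := congrArg (P.map (homOfLE hWV').op) hf
      rw [map_zsmul, map_zero, ← CategoryTheory.comp_apply, ← P.map_comp] at h4
      exact h4
    refine ⟨W, hxW, hWV'.trans (f.le.trans hVU), ?_⟩
    calc ((presheafToSheaf (Opens.grothendieckTopology X) AddCommGrpCat.{u}).obj P).obj.map
          (homOfLE (hWV'.trans (f.le.trans hVU))).op t
        = ((presheafToSheaf (Opens.grothendieckTopology X) AddCommGrpCat.{u}).obj P).obj.map
            (homOfLE hWV' ≫ f).op
            (((presheafToSheaf (Opens.grothendieckTopology X) AddCommGrpCat.{u}).obj P).obj.map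
              (homOfLE hVU).op t) := by
          rw [← CategoryTheory.comp_apply, ← Functor.map_comp]
          rfl
      _ = ((presheafToSheaf (Opens.grothendieckTopology X) AddCommGrpCat.{u}).obj P).obj.map
            (homOfLE hWV' ≫ f).op
            ((toSheafify (Opens.grothendieckTopology X) P).app (op V) s) := by
          rw [hs']
      _ = (toSheafify (Opens.grothendieckTopology X) P).app (op W)
            (P.map (homOfLE hWV' ≫ f).op s) :=
          (toSheafify_app_map P (homOfLE hWV' ≫ f) s).symm
      _ = 0 := by rw [h3, map_zero]
  choose W hxW hWU hW0 using key
  refine TopCat.Sheaf.eq_of_locally_eq'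
    ((presheafToSheaf (Opens.grothendieckTopology X) AddCommGrpCat.{u}).obj P) W U
    (fun x => homOfLE (hWU x))
    (fun x hx => Opens.mem_iSup.2 ⟨⟨x, hx⟩, hxW ⟨x, hx⟩⟩) t 0 fun x => ?_
  rw [hW0, map_zero]

/-- **`q • 𝟙 P♯` is mono for a locally `q`-torsion-free presheaf `P`.** [folklore] -/
theorem mono_zsmul_id_sheafify_of_locally
    (h : ∀ (U : Opens X) (x : X), x ∈ U →
      ∃ W : Opens X, x ∈ W ∧ W ≤ U ∧ ∀ s : P.obj (op W), q • s = 0 → s = 0) :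
    Mono (q • 𝟙 ((presheafToSheaf (Opens.grothendieckTopology X) AddCommGrpCat.{u}).obj P)) :=
  mono_zsmul_id_of_forall _ q fun U t ht =>
    sheafify_eq_zero_of_zsmul_eq_zero_of_locally P q h U.unop t ht

end Literature.AlgebraicGeometry.Modules
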